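import Literature.MeasureTheory.Group.ConjugationWeylVanishing
import Literature.NumberTheory.Automorphic.OrbitalMeasureCanonicalAtPoint
import HarnessLib

/-!
# Vanishing Haar integral from vanishing CANONICAL regular orbital integrals
(the vanishing form of the Weyl integration formula, [HarishChandra1970, Lemma 42], for canonical orbital measure families)

Topic `NumberTheory/Automorphic`; namespace `Literature.NumberTheory.Automorphic`.  Theorems only (no definition, no
named fact, no instance, no `sorry`).  Sequel of ★ `Literature.MeasureTheory.Group.ConjugationWeylVanishing` (the
Jacobian-free Weyl integration formula on the `T`-regular set, one torus at a time) and of ★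
`OrbitalMeasureCanonicalAtPoint` (a canonical family read at any representative).

SETTING.  `G` a locally compact, second countable Hausdorff group, `ν` a Haar measure on `G` which is also right
invariant, `R ⊆ G` an OPEN, CONULL, conjugation-invariant set of «regular» elements satisfying the TORUS AXIOMS at every
`γ ∈ R`, `T_γ := Z_G(γ)`:
  (ab) `T_γ` is abelian;  (zz) `Z_G(t) = T_γ` for every `t ∈ T_γ ∩ R`;  (w) `N_G(T_γ) ∕ T_γ` is finite;
  (op) `G^{T_γ} := ⋃_x x (T_γ ∩ R) x⁻¹` is open;  (ex) `T_γ` carries an inversion-invariant Haar measure of mass one on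
  its compact core (so that the canonical normalisation ★ `OrbitalMeasureFamily.IsCanonical` is satisfiable at `γ`).
`m` is a CANONICAL orbital measure family for `(R, ν)` (★ `IsCanonical`: at every regular class `m ⟦a⟧ = ν ∕ t` with
`t` THE Haar measure on `Z(out ⟦a⟧)` of compact-core mass one).

THE RESULTS (all PROVED).
* `image_conjFamily_regularSet_eq` — `Φ_γ(D_γ) = G^{T_γ}` for the conjugation family `Φ_γ(xT_γ, t) = x t x⁻¹`.
* `image_conjFamily_regularSet_eq_of_mem` — two such sets `G^{T_γ}`, `G^{T_γ'}` (`γ, γ' ∈ R`) are EQUAL OR DISJOINT.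
* `integral_descConj_quotientMeasure_eq_classOrbitalIntegral` — for `t ∈ T_γ ∩ R` and any inversion-invariant Haar
  measure `tm` on `T_γ` of compact-core mass one, `∫_{G ⧸ T_γ} g(x t x⁻¹) d(ν ∕ tm) = classOrbitalIntegral m g ⟦t⟧`
  (★ `IsCanonical.classOrbitalIntegral_mk_eq_orbitalIntegral'` at `t`, transported along `Z(t) = T_γ` with ★
  `map_cosetCongr_quotientMeasure`).
* **`integral_eq_zero_of_forall_classOrbitalIntegral_eq_zero`** — THE VANISHING THEOREM: if `g ∈ L¹(ν)` has
  `classOrbitalIntegral m g ⟦a⟧ = 0` for every `a ∈ R`, then `∫_G g dν = 0`.  Proof: ★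
  `setIntegral_image_conjFamily_eq_zero` on each `G^{T_γ}`, glued by ★
  `integral_eq_zero_of_forall_isOpen_setIntegral_eq_zero` (the `G^{T_γ}` are open, pairwise equal or disjoint, and
  cover the conull `R`).

WHY (the use).  With `G = H_v = U(Φ₂)(L⁺_v) × U(Φ₁)(L⁺_v)` at a split place and `R` the `G`-regular set this is the stub
`stub_weylVanishingSplit` of the P3b line «CMCharIdentityTest» modulo the five torus axioms and conullity for `H_v`
(bricks W-B∕W-D of the road «W1s soft Weyl»).  No Jacobian ∕ Weyl discriminant is computed anywhere.
[cite: HarishChandra1970, Lemma 42] («`∫_{G_A} f dx = [W_A]⁻¹ ∫_A |D(a)| da ∫_{G∕A} f(a^{x*}) dx*`», here only its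
consequence `Φ(a, f) ≡ 0 on A′ ⇒ ∫_{G_A} f = 0`); [cite: Rogawski1990, §12.5 p. 182] (the Weyl integration formula on
`U(2) × U(1)` used in §12.5–12.7).

## References
* [HarishChandra1970] Harish-Chandra (notes by G. van Dijk), *Harmonic Analysis on Reductive p-adic Groups*, LNM 162
  (1970), Lemma 42 (`W_A = Ã∕A`, `G_A = (A′)^G`).
* [Rogawski1990] J. D. Rogawski, *Automorphic Representations of Unitary Groups in Three Variables* (1990), §12.5 p. 182.
* [Weil1965] A. Weil, Acta Math. 113 (1965), n° 49 Lemme 22 (relative uniqueness of invariant measures).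
-/

set_option autoImplicit false

noncomputable section

open MeasureTheory Measure Set Filter Topology Function
open Literature.MeasureTheory.Group
open scoped ENNReal NNReal Pointwise

namespace Literature.NumberTheory.Automorphic

section Sets

variable {G : Type*} [Group G] (T : Subgroup G) (Φ : (G ⧸ T) × T → G)
  (hΦ : ∀ (x : G) (t : T), Φ (QuotientGroup.mk x, t) = x * t * x⁻¹) (R : Set G)

include hΦ in
/-- `Φ(D) = ⋃_x x (T ∩ R) x⁻¹` for the conjugation family `Φ(xT, t) = x t x⁻¹` and `D = {(xT, t) | t ∈ R}`.
[cite: HarishChandra1970, Lemma 42] -/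
theorem image_conjFamily_regularSet_eq :
    Φ '' {p : (G ⧸ T) × T | ((p.2 : T) : G) ∈ R} = ⋃ x : G, (fun t : G => x * t * x⁻¹) '' ((T : Set G) ∩ R) := by
  ext y
  simp only [mem_image, mem_setOf_eq, mem_iUnion, mem_inter_iff, SetLike.mem_coe]
  constructor
  · rintro ⟨⟨q, t⟩, ht, rfl⟩
    obtain ⟨x, rfl⟩ := QuotientGroup.mk_surjective q
    exact ⟨x, t, ⟨t.2, ht⟩, (hΦ x t).symm⟩
  · rintro ⟨x, t, ⟨htT, htR⟩, rfl⟩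
    exact ⟨(QuotientGroup.mk x, ⟨t, htT⟩), htR, hΦ x ⟨t, htT⟩⟩

/-- **The regular sets attached to two regular elements are EQUAL OR DISJOINT**: if `x t x⁻¹ = x' t' x'⁻¹` with
`t ∈ Z(γ) ∩ R`, `t' ∈ Z(γ') ∩ R`, then (with `Z(t) = Z(γ)`, `Z(t') = Z(γ')`) conjugation by `x'⁻¹ x` carries
`Z(γ) ∩ R` into `Z(γ') ∩ R`, so `G^{Z(γ)} ⊆ G^{Z(γ')}` and symmetrically. [cite: HarishChandra1970, Lemma 42] -/
theorem iUnion_conj_centralizer_eq_or_disjoint (hRc : ∀ g x : G, x ∈ R → g * x * g⁻¹ ∈ R)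
    (hZZ : ∀ γ ∈ R, ∀ t ∈ Subgroup.centralizer ({γ} : Set G), t ∈ R →
      Subgroup.centralizer ({t} : Set G) = Subgroup.centralizer ({γ} : Set G))
    {γ γ' : G} (hγ : γ ∈ R) (hγ' : γ' ∈ R) :
    (⋃ x : G, (fun t : G => x * t * x⁻¹) '' ((Subgroup.centralizer ({γ} : Set G) : Set G) ∩ R)) =
        (⋃ x : G, (fun t : G => x * t * x⁻¹) '' ((Subgroup.centralizer ({γ'} : Set G) : Set G) ∩ R)) ∨
      Disjoint (⋃ x : G, (fun t : G => x * t * x⁻¹) '' ((Subgroup.centralizer ({γ} : Set G) : Set G) ∩ R))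
        (⋃ x : G, (fun t : G => x * t * x⁻¹) '' ((Subgroup.centralizer ({γ'} : Set G) : Set G) ∩ R)) := by
  classical
  -- one inclusion from one common point, for an arbitrary ordered pair of regular elements
  have key : ∀ {a a' : G}, a ∈ R → a' ∈ R → ∀ {x x' s s' : G},
      s ∈ Subgroup.centralizer ({a} : Set G) → s ∈ R → s' ∈ Subgroup.centralizer ({a'} : Set G) → s' ∈ R →
      x * s * x⁻¹ = x' * s' * x'⁻¹ →
      (⋃ y : G, (fun t : G => y * t * y⁻¹) '' ((Subgroup.centralizer ({a} : Set G) : Set G) ∩ R)) ⊆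
        ⋃ y : G, (fun t : G => y * t * y⁻¹) '' ((Subgroup.centralizer ({a'} : Set G) : Set G) ∩ R) := by
    intro a a' ha ha' x x' s s' hs hsR hs' hs'R heq z hz
    simp only [mem_iUnion, mem_image, mem_inter_iff, SetLike.mem_coe] at hz ⊢
    obtain ⟨y, r, ⟨hr, hrR⟩, rfl⟩ := hz
    -- `n := x'⁻¹ x` conjugates `s` to `s'`; `r ∈ Z(a) = Z(s)` so `n r n⁻¹ ∈ Z(n s n⁻¹) = Z(s') = Z(a')`
    set n : G := x'⁻¹ * x with hn
    have hns : n * s * n⁻¹ = s' := by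
      rw [hn]
      calc x'⁻¹ * x * s * (x'⁻¹ * x)⁻¹ = x'⁻¹ * (x * s * x⁻¹) * x' := by group
        _ = x'⁻¹ * (x' * s' * x'⁻¹) * x' := by rw [heq]
        _ = s' := by group
    have hrs : r ∈ Subgroup.centralizer ({s} : Set G) := by rw [hZZ a ha s hs hsR]; exact hr
    have hnr : n * r * n⁻¹ ∈ Subgroup.centralizer ({a'} : Set G) := by
      rw [← hZZ a' ha' s' hs' hs'R, Subgroup.mem_centralizer_singleton_iff, ← hns]
      rw [Subgroup.mem_centralizer_singleton_iff] at hrs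
      calc n * r * n⁻¹ * (n * s * n⁻¹) = n * (r * s) * n⁻¹ := by group
        _ = n * (s * r) * n⁻¹ := by rw [hrs]
        _ = n * s * n⁻¹ * (n * r * n⁻¹) := by group
    refine ⟨y * n⁻¹, n * r * n⁻¹, ⟨hnr, hRc n r hrR⟩, ?_⟩
    group
  by_cases hd : Disjoint (⋃ x : G, (fun t : G => x * t * x⁻¹) '' ((Subgroup.centralizer ({γ} : Set G) : Set G) ∩ R))
      (⋃ x : G, (fun t : G => x * t * x⁻¹) '' ((Subgroup.centralizer ({γ'} : Set G) : Set G) ∩ R))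
  · exact Or.inr hd
  · left
    obtain ⟨z, hz, hz'⟩ := Set.not_disjoint_iff.1 hd
    simp only [mem_iUnion, mem_image, mem_inter_iff, SetLike.mem_coe] at hz hz'
    obtain ⟨x, s, ⟨hs, hsR⟩, rfl⟩ := hz
    obtain ⟨x', s', ⟨hs', hs'R⟩, heq⟩ := hz'
    exact Subset.antisymm (key hγ hγ' hs hsR hs' hs'R heq.symm) (key hγ' hγ hs' hs'R hs hsR heq)

end Sets

section Canonical

variable {G : Type*} [Group G] [TopologicalSpace G] [IsTopologicalGroup G] [LocallyCompactSpace G]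
  [SecondCountableTopology G] [T2Space G] [MeasurableSpace G] [BorelSpace G]
  [∀ γ : G, MeasurableSpace (G ⧸ Subgroup.centralizer ({γ} : Set G))]
  [∀ γ : G, BorelSpace (G ⧸ Subgroup.centralizer ({γ} : Set G))]
  (ν : Measure G) [ν.IsHaarMeasure] [ν.IsMulRightInvariant]

/-- The image of an inversion-invariant measure under an isomorphism of topological groups is inversion invariant
(private copy of ★ `isInvInvariant_map_continuousMulEquiv`, kept here for a light import closure). [folklore] -/
private theorem isInvInvariant_map_continuousMulEquiv_aux {A B : Type*} [Group A] [Group B] [TopologicalSpace A]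
    [TopologicalSpace B] [IsTopologicalGroup A] [IsTopologicalGroup B] [MeasurableSpace A] [BorelSpace A]
    [MeasurableSpace B] [BorelSpace B] (e : A ≃ₜ* B) (μ : Measure A) [μ.IsInvInvariant] :
    (Measure.map e μ).IsInvInvariant := by
  have hem : Measurable (e : A → B) := e.continuous.measurable
  refine ⟨?_⟩
  rw [Measure.inv, Measure.map_map measurable_inv hem]
  have h1 : (Inv.inv ∘ (e : A → B)) = (e : A → B) ∘ Inv.inv := funext fun a => (map_inv e a).symm
  rw [h1, ← Measure.map_map hem measurable_inv, Measure.map_inv_eq_self]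

/-- **Transport along an EQUALITY of centralisers**: if `Z(t) = Z(γ) =: T`, `tm` is an inversion-invariant Haar measure
on `T` with compact-core mass one and `m` is canonical for the conjugation-invariant `R ∋ t`, then
`∫_{G ⧸ T} g(x t x⁻¹) d(ν ∕ tm)(xT) = classOrbitalIntegral m g ⟦t⟧` (★ `classOrbitalIntegral_mk_eq_orbitalIntegral'` at
`t` for the transported measure on `Z(t)`, then ★ `map_cosetCongr_quotientMeasure` along the identity of `G`).
[cite: HarishChandra1970, Lemma 42] [cite: Rogawski1990, §4.3 (4.3.1) p. 43] -/
theorem integral_descConj_quotientMeasure_eq_classOrbitalIntegral {R : Set G}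
    (hRc : ∀ g x : G, x ∈ R → g * x * g⁻¹ ∈ R) {m : OrbitalMeasureFamily G} (hm : m.IsCanonical (· ∈ R) ν)
    {γ t : G} (ht : t ∈ R) (hZ : Subgroup.centralizer ({t} : Set G) = Subgroup.centralizer ({γ} : Set G))
    (hcomm : ∀ x ∈ Subgroup.centralizer ({γ} : Set G), x * t = t * x)
    (tm : Measure (Subgroup.centralizer ({γ} : Set G))) [tm.IsHaarMeasure] [tm.IsInvInvariant]
    (htm : tm (compactCore (Subgroup.centralizer ({γ} : Set G))) = 1)
    {E : Type*} [NormedAddCommGroup E] [NormedSpace ℝ E] (g : G → E) :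
    ∫ q, descConj t (Subgroup.centralizer ({γ} : Set G)) hcomm g q
        ∂(quotientMeasure (Subgroup.centralizer ({γ} : Set G)) tm (isClosed_coe_centralizer_singleton γ) ν) =
      classOrbitalIntegral m g (ConjClasses.mk t) := by
  classical
  haveI hZc : IsClosed ((Subgroup.centralizer ({γ} : Set G) : Subgroup G) : Set G) :=
    isClosed_coe_centralizer_singleton γ
  haveI hZtc : IsClosed ((Subgroup.centralizer ({t} : Set G) : Subgroup G) : Set G) :=
    isClosed_coe_centralizer_singleton t
  haveI : LocallyCompactSpace (Subgroup.centralizer ({γ} : Set G)) := hZc.isClosedEmbedding_subtypeVal.locallyCompactSpace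
  haveI : LocallyCompactSpace (Subgroup.centralizer ({t} : Set G)) := hZtc.isClosedEmbedding_subtypeVal.locallyCompactSpace
  haveI : SecondCountableTopology (Subgroup.centralizer ({γ} : Set G)) := TopologicalSpace.Subtype.secondCountableTopology _
  haveI : SecondCountableTopology (Subgroup.centralizer ({t} : Set G)) := TopologicalSpace.Subtype.secondCountableTopology _
  have he : Continuous (MulEquiv.refl G) := continuous_id
  have hes : Continuous (MulEquiv.refl G).symm := continuous_id
  have hmem : ∀ x : G, (MulEquiv.refl G) x ∈ Subgroup.centralizer ({γ} : Set G) ↔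
      x ∈ Subgroup.centralizer ({t} : Set G) := fun x => by rw [MulEquiv.refl_apply, hZ]
  -- the identity `Z(t) ≃ₜ Z(γ)` and its `≃ₜ*` structure
  let eH : Subgroup.centralizer ({t} : Set G) ≃ₜ Subgroup.centralizer ({γ} : Set G) :=
    subgroupCongrHomeomorph (MulEquiv.refl G) _ _ hmem he hes
  let eZ : Subgroup.centralizer ({t} : Set G) ≃ₜ* Subgroup.centralizer ({γ} : Set G) :=
    { toMulEquiv := { toEquiv := eH.toEquiv, map_mul' := fun a b => Subtype.ext rfl }
      continuous_toFun := eH.continuous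
      continuous_invFun := eH.symm.continuous }
  -- the transported normalising measure on `Z(t)`
  set t' : Measure (Subgroup.centralizer ({t} : Set G)) := Measure.map eZ.symm tm with ht'def
  haveI : t'.IsInvInvariant := isInvInvariant_map_continuousMulEquiv_aux eZ.symm tm
  have ht'1 : t' (compactCore (Subgroup.centralizer ({t} : Set G))) = 1 := by
    have hco : (⇑eZ.symm : _ → Subgroup.centralizer ({t} : Set G)) = ⇑(eZ.symm.toHomeomorph.toMeasurableEquiv) := rfl
    have hpre : ⇑eZ.symm ⁻¹' compactCore (Subgroup.centralizer ({t} : Set G)) =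
        compactCore (Subgroup.centralizer ({γ} : Set G)) := by
      rw [← image_compactCore eZ.symm]; exact eZ.symm.injective.preimage_image _
    rw [ht'def, hco, MeasurableEquiv.map_apply, ← hco, hpre, htm]
  -- (i) the canonical family read at the representative `t`
  have hP : ∀ g x : G, g ∈ R → x * g * x⁻¹ ∈ R := fun g x hg => hRc x g hg
  have h1 := hm.classOrbitalIntegral_mk_eq_orbitalIntegral' hP ht t' ht'1 g
  -- (ii) transport of the quotient measure along `Z(t) = Z(γ)`
  have hρ' : tm = Measure.map eH t' := by
    have hm1 : Measurable (eH : _ → Subgroup.centralizer ({γ} : Set G)) := eH.continuous.measurable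
    have hm2 : Measurable (eZ.symm : _ → Subgroup.centralizer ({t} : Set G)) := eZ.symm.continuous.measurable
    rw [ht'def, Measure.map_map hm1 hm2]
    have hid : (⇑eH ∘ ⇑eZ.symm) = id := funext fun x => eH.apply_symm_apply x
    rw [hid, Measure.map_id]
  have hν' : ν = Measure.map (MulEquiv.refl G) ν := by
    change ν = Measure.map id ν
    rw [Measure.map_id]
  have h2 := map_cosetCongr_quotientMeasure (MulEquiv.refl G) he hes _ _ hmem t' tm ν ν hρ' hν'
  rw [h1, orbitalIntegral_eq_integral_descConj, ← h2,
    ← coe_cosetCongrHomeomorph (MulEquiv.refl G) _ _ hmem he hes, ← Homeomorph.toMeasurableEquiv_coe,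
    integral_map_equiv]
  refine integral_congr_ae (Eventually.of_forall fun q => ?_)
  induction q using QuotientGroup.induction_on with
  | H x => rfl

/-- **THE VANISHING THEOREM for canonical orbital measure families.**  `G` locally compact second countable Hausdorff,
`ν` a Haar measure also right invariant, `R ⊆ G` open, conull and conjugation invariant with the torus axioms at every
`γ ∈ R` (`Z(γ)` abelian; `Z(t) = Z(γ)` for `t ∈ Z(γ) ∩ R`; `N(Z(γ)) ∕ Z(γ)` finite; `⋃_x x (Z(γ) ∩ R) x⁻¹` open; an
inversion-invariant Haar measure of compact-core mass one on `Z(γ)`), `m` canonical for `(R, ν)`.  If `g ∈ L¹(ν)` has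
`classOrbitalIntegral m g ⟦a⟧ = 0` for all `a ∈ R` then `∫_G g dν = 0`. [cite: HarishChandra1970, Lemma 42]
[cite: Rogawski1990, §12.5 p. 182] -/
theorem integral_eq_zero_of_forall_classOrbitalIntegral_eq_zero {R : Set G} (hRo : IsOpen R) (hRν : ν Rᶜ = 0)
    (hRc : ∀ g x : G, x ∈ R → g * x * g⁻¹ ∈ R)
    (hab : ∀ γ ∈ R, ∀ a ∈ Subgroup.centralizer ({γ} : Set G), ∀ b ∈ Subgroup.centralizer ({γ} : Set G), a * b = b * a)
    (hZZ : ∀ γ ∈ R, ∀ t ∈ Subgroup.centralizer ({γ} : Set G), t ∈ R →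
      Subgroup.centralizer ({t} : Set G) = Subgroup.centralizer ({γ} : Set G))
    (hW : ∀ γ ∈ R, ((Subgroup.centralizer ({γ} : Set G)).subgroupOf
      (Subgroup.normalizer ((Subgroup.centralizer ({γ} : Set G) : Subgroup G) : Set G))).index ≠ 0)
    (hopen : ∀ γ ∈ R, IsOpen (⋃ x : G, (fun t : G => x * t * x⁻¹) '' ((Subgroup.centralizer ({γ} : Set G) : Set G) ∩ R)))
    (hex : ∀ γ ∈ R, ∃ t : Measure (Subgroup.centralizer ({γ} : Set G)), t.IsHaarMeasure ∧ t.IsInvInvariant ∧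
      t (compactCore (Subgroup.centralizer ({γ} : Set G))) = 1)
    {m : OrbitalMeasureFamily G} (hm : m.IsCanonical (· ∈ R) ν)
    {E : Type*} [NormedAddCommGroup E] [NormedSpace ℝ E] (g : G → E) (hg : Integrable g ν)
    (h0 : ∀ a ∈ R, classOrbitalIntegral m g (ConjClasses.mk a) = 0) :
    ∫ x, g x ∂ν = 0 := by
  classical
  -- the open pieces `G^{Z(γ)}`, `γ ∈ R`
  refine integral_eq_zero_of_forall_isOpen_setIntegral_eq_zero ν
    (fun γ : R => ⋃ x : G, (fun t : G => x * t * x⁻¹) '' ((Subgroup.centralizer ({(γ : G)} : Set G) : Set G) ∩ R))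
    (fun γ => hopen γ γ.2) (fun γ γ' => iUnion_conj_centralizer_eq_or_disjoint R hRc hZZ γ.2 γ'.2) ?_ g hg ?_
  · -- the pieces cover `R`, which is conull
    have hsub : R ⊆ ⋃ γ : R, ⋃ x : G,
        (fun t : G => x * t * x⁻¹) '' ((Subgroup.centralizer ({(γ : G)} : Set G) : Set G) ∩ R) := by
      intro y hyR
      simp only [mem_iUnion, mem_image, mem_inter_iff, SetLike.mem_coe]
      exact ⟨⟨y, hyR⟩, 1, y, ⟨Subgroup.mem_centralizer_singleton_iff.2 rfl, hyR⟩, by group⟩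
    exact measure_mono_null (compl_subset_compl.2 hsub) hRν
  · -- on each piece the integral vanishes: the one-torus theorem for `T = Z(γ)`
    rintro ⟨γ, hγ⟩
    haveI hT : IsClosed ((Subgroup.centralizer ({γ} : Set G) : Subgroup G) : Set G) := isClosed_coe_centralizer_singleton γ
    have hTc := hab γ hγ
    -- the conjugation family of `Z(γ)`
    let Φ : (G ⧸ Subgroup.centralizer ({γ} : Set G)) × Subgroup.centralizer ({γ} : Set G) → G := fun p =>
      descConj (p.2 : G) (Subgroup.centralizer ({γ} : Set G)) (fun x hx => hTc x hx p.2 p.2.2) id p.1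
    have hΦ : ∀ (x : G) (t : Subgroup.centralizer ({γ} : Set G)), Φ (QuotientGroup.mk x, t) = x * t * x⁻¹ :=
      fun x t => rfl
    obtain ⟨tm, htmH, htmI, htm1⟩ := hex γ hγ
    haveI := htmH
    haveI := htmI
    have hRT : ∀ t : Subgroup.centralizer ({γ} : Set G), (t : G) ∈ R →
        Subgroup.centralizer ({(t : G)} : Set G) = Subgroup.centralizer ({γ} : Set G) := fun t ht => hZZ γ hγ t t.2 ht
    have himg := image_conjFamily_regularSet_eq (Subgroup.centralizer ({γ} : Set G)) Φ hΦ R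
    change ∫ y in ⋃ x : G, (fun t : G => x * t * x⁻¹) '' ((Subgroup.centralizer ({γ} : Set G) : Set G) ∩ R), g y ∂ν = 0
    rw [← himg]
    refine setIntegral_image_conjFamily_eq_zero (Subgroup.centralizer ({γ} : Set G)) hT hTc ν Φ hΦ R
      hRo.measurableSet hRT hRc (hW γ hγ) tm g hg.integrableOn fun t ht => ?_
    -- the orbital integral over `G ⧸ Z(γ)` at `t ∈ Z(γ) ∩ R` is the canonical class orbital integral at `⟦t⟧`
    have hcomm : ∀ x ∈ Subgroup.centralizer ({γ} : Set G), x * (t : G) = (t : G) * x := fun x hx => hTc x hx t t.2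
    have hpt : (fun q => g (Φ (q, t))) = descConj (t : G) (Subgroup.centralizer ({γ} : Set G)) hcomm g := by
      funext q
      induction q using QuotientGroup.induction_on with
      | H x => rfl
    rw [hpt, integral_descConj_quotientMeasure_eq_classOrbitalIntegral ν hRc hm ht (hRT t ht) hcomm tm htm1 g]
    exact h0 t ht

end Canonical

end Literature.NumberTheory.Automorphic

end
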